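import Summits.QuantumFields.QCD.Theses.NestedDissectionSea
import Literature.Barriers.QuantumFields.WilsonDeterminantSign

/-!
# Stub `stub_frullaniToolkit` of line `proper-time-quarantine`
(crux `Summit.QuantumFields.QCD.Theses.NestedDissectionSea.SeaFactorisationBridge`,
item stmt-QuantumFields-13880)

Scalar Frullani toolkit: the proper-time representation of `log` cut at `t₀`, tail bounds for
`E₁`, and two bounds on the UV profile. Mathlib real analysis only.

The Frullani identity (a) is proved without Fubini or differentiation under the integral sign:
for every `0 < ε ≤ t₀` the substitution `s = tλ` gives
`∫_{(ε,t₀]} (e^{-tλ} - e^{-t})/t dt = (E₁(ελ) - E₁(ε)) - (E₁(t₀λ) - E₁(t₀))`, while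
`|E₁(ε) - E₁(ελ) - log λ| ≤ ε|λ - 1|` and `|∫_{(0,ε]} (e^{-tλ} - e^{-t})/t dt| ≤ ε|λ - 1|`;
letting `ε → 0⁺` yields the claim.
-/

noncomputable section

namespace Summit.QuantumFields.QCD.Cruxes.SeaFactorisationBridge.ProperTimeQuarantine

open scoped BigOperators Topology Classical MeasureTheory Matrix ComplexConjugate ComplexOrder
open Filter MeasureTheory
open Literature.MathematicalPhysics.QuantumFieldTheory Literature.MathematicalPhysics.QuantumLattice
open Literature.Probability.LatticeModels

/-- `exp (-·)` is `1`-Lipschitz on `[0, ∞)`. -/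
theorem frullani_abs_exp_neg_sub_le {a b : ℝ} (ha : 0 ≤ a) (hb : 0 ≤ b) :
    |Real.exp (-a) - Real.exp (-b)| ≤ |a - b| := by
  wlog hab : a ≤ b generalizing a b
  · rw [abs_sub_comm, abs_sub_comm a b]
    exact this hb ha (le_of_not_ge hab)
  have h1 : Real.exp (-b) ≤ Real.exp (-a) := Real.exp_le_exp.mpr (neg_le_neg hab)
  rw [abs_of_nonneg (sub_nonneg.mpr h1), abs_of_nonpos (sub_nonpos.mpr hab)]
  have h2 : 1 - (b - a) ≤ Real.exp (-(b - a)) := by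
    have := Real.add_one_le_exp (-(b - a))
    linarith
  have h3 : Real.exp (-b) = Real.exp (-a) * Real.exp (-(b - a)) := by
    rw [← Real.exp_add]
    congr 1
    ring
  have h4 : Real.exp (-a) ≤ 1 := Real.exp_le_one_iff.mpr (neg_nonpos.mpr ha)
  rw [h3]
  nlinarith [mul_le_mul_of_nonneg_left h2 (Real.exp_pos (-a)).le,
    mul_le_mul_of_nonneg_right h4 (sub_nonneg.mpr hab)]

/-- Pointwise bound `|(e^{-tλ} - e^{-t})/t| ≤ |λ - 1|` for `t > 0`, `λ ≥ 0`. -/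
theorem frullani_abs_integrand_le {t lam : ℝ} (ht : 0 < t) (hlam : 0 ≤ lam) :
    |(Real.exp (-(t * lam)) - Real.exp (-t)) / t| ≤ |lam - 1| := by
  rw [abs_div, abs_of_pos ht, div_le_iff₀ ht]
  calc |Real.exp (-(t * lam)) - Real.exp (-t)| ≤ |t * lam - t| :=
        frullani_abs_exp_neg_sub_le (mul_nonneg ht.le hlam) ht.le
    _ = |lam - 1| * t := by
        rw [show t * lam - t = (lam - 1) * t by ring, abs_mul, abs_of_pos ht]

/-- Pointwise bound `|(e^{-tλ} - e^{-t})/t| ≤ t⁻¹` for `t > 0`, `λ ≥ 0`. -/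
theorem frullani_abs_integrand_le_inv {t lam : ℝ} (ht : 0 < t) (hlam : 0 ≤ lam) :
    |(Real.exp (-(t * lam)) - Real.exp (-t)) / t| ≤ t⁻¹ := by
  rw [abs_div, abs_of_pos ht, div_le_iff₀ ht, inv_mul_cancel₀ ht.ne', abs_le]
  have h1 : Real.exp (-(t * lam)) ≤ 1 :=
    Real.exp_le_one_iff.mpr (neg_nonpos.mpr (mul_nonneg ht.le hlam))
  have h2 : Real.exp (-t) ≤ 1 := Real.exp_le_one_iff.mpr (neg_nonpos.mpr ht.le)
  have h3 := Real.exp_pos (-(t * lam))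
  have h4 := Real.exp_pos (-t)
  constructor <;> linarith

/-- The UV integrand is integrable on `Ioc 0 b`. -/
theorem frullani_integrableOn_Ioc {b lam : ℝ} (hlam : 0 ≤ lam) :
    IntegrableOn (fun t : ℝ => (Real.exp (-(t * lam)) - Real.exp (-t)) / t) (Set.Ioc 0 b) := by
  have hmeas : AEStronglyMeasurable (fun t : ℝ => (Real.exp (-(t * lam)) - Real.exp (-t)) / t)
      (volume.restrict (Set.Ioc 0 b)) :=
    Measurable.aestronglyMeasurable (by fun_prop)
  refine Integrable.mono' (g := fun _ => |lam - 1|) (integrableOn_const measure_Ioc_lt_top.ne)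
    hmeas ?_
  filter_upwards [ae_restrict_mem measurableSet_Ioc] with t ht
  rw [Real.norm_eq_abs]
  exact frullani_abs_integrand_le ht.1 hlam

/-- `e^{-tλ}/t` is integrable on `Ioi x` for `x > 0`, `λ > 0`. -/
theorem frullani_integrableOn_exp_div {x lam : ℝ} (hx : 0 < x) (hlam : 0 < lam) :
    IntegrableOn (fun t : ℝ => Real.exp (-(t * lam)) / t) (Set.Ioi x) := by
  have h0 : IntegrableOn (fun t : ℝ => Real.exp (-lam * t) / x) (Set.Ioi x) :=
    (exp_neg_integrableOn_Ioi x hlam).div_const x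
  refine Integrable.mono' h0 (Measurable.aestronglyMeasurable (by fun_prop)) ?_
  filter_upwards [ae_restrict_mem measurableSet_Ioi] with t ht
  have ht0 : 0 < t := hx.trans ht
  rw [Real.norm_eq_abs, abs_of_pos (div_pos (Real.exp_pos _) ht0), neg_mul, mul_comm lam t]
  exact div_le_div_of_nonneg_left (Real.exp_pos _).le hx ht.le

/-- `e^{-s}/s` is integrable on `Ioi x` for `x > 0`. -/
theorem frullani_integrableOn_exp_neg_div {x : ℝ} (hx : 0 < x) :
    IntegrableOn (fun s : ℝ => Real.exp (-s) / s) (Set.Ioi x) := by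
  simpa using frullani_integrableOn_exp_div hx one_pos

/-- Substitution `s = tλ`: `∫_{(x,∞)} e^{-tλ}/t dt = E₁(xλ)`. -/
theorem frullani_integral_exp_div_Ioi (x : ℝ) {lam : ℝ} (hlam : 0 < lam) :
    ∫ t in Set.Ioi x, Real.exp (-(t * lam)) / t = ∫ s in Set.Ioi (x * lam), Real.exp (-s) / s := by
  have h := integral_comp_mul_right_Ioi (fun s => Real.exp (-s) / s) x hlam
  simp only [smul_eq_mul] at h
  have h2 : ∀ t : ℝ, Real.exp (-(t * lam)) / t = lam * (Real.exp (-(t * lam)) / (t * lam)) := by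
    intro t
    rw [← mul_div_assoc, mul_comm lam (Real.exp _), mul_div_mul_right _ _ hlam.ne']
  simp_rw [h2]
  rw [integral_const_mul, h, ← mul_assoc, mul_inv_cancel₀ hlam.ne', one_mul]

/-- On `Ioi x` (`x > 0`) the UV integrand is integrable with integral `E₁(xλ) - E₁(x)`. -/
theorem frullani_integral_uv_Ioi {x lam : ℝ} (hx : 0 < x) (hlam : 0 < lam) :
    IntegrableOn (fun t : ℝ => (Real.exp (-(t * lam)) - Real.exp (-t)) / t) (Set.Ioi x) ∧
      ∫ t in Set.Ioi x, (Real.exp (-(t * lam)) - Real.exp (-t)) / t =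
        (∫ s in Set.Ioi (x * lam), Real.exp (-s) / s) - ∫ s in Set.Ioi x, Real.exp (-s) / s := by
  have h1 := frullani_integrableOn_exp_div hx hlam
  have h2 := frullani_integrableOn_exp_neg_div hx
  have hfg : (fun t : ℝ => (Real.exp (-(t * lam)) - Real.exp (-t)) / t) =
      fun t => Real.exp (-(t * lam)) / t - Real.exp (-t) / t := by
    funext t
    exact sub_div _ _ _
  refine ⟨by rw [hfg]; exact h1.sub h2, ?_⟩
  rw [hfg, integral_sub h1 h2, frullani_integral_exp_div_Ioi x hlam]

/-- `E₁(ε) - E₁(ελ)` is within `ε|λ - 1|` of `log λ`. -/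
theorem frullani_abs_expInt_sub_expInt_sub_log_le {ε lam : ℝ} (hε : 0 < ε) (hlam : 0 < lam) :
    |(∫ s in Set.Ioi ε, Real.exp (-s) / s) - (∫ s in Set.Ioi (ε * lam), Real.exp (-s) / s) -
        Real.log lam| ≤ ε * |lam - 1| := by
  have hεl : 0 < ε * lam := mul_pos hε hlam
  rw [intervalIntegral.integral_Ioi_sub_Ioi' (frullani_integrableOn_exp_neg_div hε)
    (frullani_integrableOn_exp_neg_div hεl)]
  have hlog : Real.log lam = ∫ s in ε..(ε * lam), s⁻¹ := by
    rw [integral_inv_of_pos hε hεl, mul_div_cancel_left₀ _ hε.ne']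
  have hpos : ∀ s ∈ Set.uIcc ε (ε * lam), 0 < s := by
    intro s hs
    rcases le_total ε (ε * lam) with h | h
    · rw [Set.uIcc_of_le h] at hs
      exact hε.trans_le hs.1
    · rw [Set.uIcc_of_ge h] at hs
      exact hεl.trans_le hs.1
  have hcont : ContinuousOn (fun s : ℝ => Real.exp (-s) / s) (Set.uIcc ε (ε * lam)) :=
    (by fun_prop : Continuous fun s : ℝ => Real.exp (-s)).continuousOn.div continuousOn_id
      fun s hs => (hpos s hs).ne'
  have hint1 : IntervalIntegrable (fun s : ℝ => Real.exp (-s) / s) volume ε (ε * lam) :=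
    hcont.intervalIntegrable
  have hint2 : IntervalIntegrable (fun s : ℝ => s⁻¹) volume ε (ε * lam) :=
    intervalIntegral.intervalIntegrable_inv (fun s hs => (hpos s hs).ne') continuousOn_id
  rw [hlog, ← intervalIntegral.integral_sub hint1 hint2]
  have hbound : ∀ s ∈ Set.uIoc ε (ε * lam), ‖Real.exp (-s) / s - s⁻¹‖ ≤ 1 := by
    intro s hs
    have hs0 : 0 < s := by
      rcases Set.mem_uIoc.mp hs with h | h
      · exact hε.trans h.1
      · exact hεl.trans h.1
    have hrw : Real.exp (-s) / s - s⁻¹ = (Real.exp (-s) - Real.exp (-0)) / s := by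
      rw [neg_zero, Real.exp_zero, sub_div, one_div]
    rw [Real.norm_eq_abs, hrw, abs_div, abs_of_pos hs0, div_le_iff₀ hs0, one_mul]
    calc |Real.exp (-s) - Real.exp (-0)| ≤ |s - 0| := frullani_abs_exp_neg_sub_le hs0.le le_rfl
      _ = s := by rw [sub_zero, abs_of_pos hs0]
  calc |∫ s in ε..(ε * lam), Real.exp (-s) / s - s⁻¹|
        = ‖∫ s in ε..(ε * lam), Real.exp (-s) / s - s⁻¹‖ := (Real.norm_eq_abs _).symm
    _ ≤ 1 * |ε * lam - ε| := intervalIntegral.norm_integral_le_of_norm_le_const hbound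
    _ = ε * |lam - 1| := by
        rw [one_mul, show ε * lam - ε = ε * (lam - 1) by ring, abs_mul, abs_of_pos hε]

/-- Part (c): `|uv(t₀,λ)| ≤ t₀|λ - 1|`. -/
theorem frullani_abs_uv_le_mul (t₀ lam : ℝ) (ht₀ : 0 < t₀) (hlam : 0 ≤ lam) :
    |(-∫ t in Set.Ioc 0 t₀, (Real.exp (-(t * lam)) - Real.exp (-t)) / t)| ≤
      t₀ * |lam - 1| := by
  rw [abs_neg]
  have h := norm_setIntegral_le_of_norm_le_const (μ := volume) (s := Set.Ioc 0 t₀)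
    (C := |lam - 1|) (f := fun t : ℝ => (Real.exp (-(t * lam)) - Real.exp (-t)) / t)
    measure_Ioc_lt_top
    (fun t ht => by rw [Real.norm_eq_abs]; exact frullani_abs_integrand_le ht.1 hlam)
  rw [Real.norm_eq_abs, Real.volume_real_Ioc_of_le ht₀.le, sub_zero, mul_comm] at h
  exact h

/-- Bookkeeping for part (a): `|-(A + ((B - C) - (D - E))) - D + E - L| ≤ 2K`. -/
theorem frullani_bookkeeping {A B C D E L K : ℝ} (h1 : |(-A)| ≤ K) (h2 : |C - B - L| ≤ K) :
    |-(A + ((B - C) - (D - E))) - D + E - L| ≤ 2 * K := by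
  have key : -(A + ((B - C) - (D - E))) - D + E - L = -A + (C - B - L) := by ring
  rw [key]
  exact (abs_add_le _ _).trans (by linarith)

/-- Part (a): `log λ = uv(t₀,λ) − E₁(t₀λ) + E₁(t₀)`. -/
theorem frullani_log_eq_uv_sub_expInt_add_expInt (t₀ lam : ℝ) (ht₀ : 0 < t₀) (hlam : 0 < lam) :
    Real.log lam =
      (-∫ t in Set.Ioc 0 t₀, (Real.exp (-(t * lam)) - Real.exp (-t)) / t) -
        (∫ s in Set.Ioi (t₀ * lam), Real.exp (-s) / s) +
          ∫ s in Set.Ioi t₀, Real.exp (-s) / s := by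
  have hI : IntegrableOn (fun t : ℝ => (Real.exp (-(t * lam)) - Real.exp (-t)) / t)
      (Set.Ioc 0 t₀) := frullani_integrableOn_Ioc hlam.le
  -- splitting at `ε`, with the middle piece expressed through `E₁`
  have hsplit : ∀ ε, 0 < ε → ε ≤ t₀ →
      ∫ t in Set.Ioc 0 t₀, (Real.exp (-(t * lam)) - Real.exp (-t)) / t =
        (∫ t in Set.Ioc 0 ε, (Real.exp (-(t * lam)) - Real.exp (-t)) / t) +
          (((∫ s in Set.Ioi (ε * lam), Real.exp (-s) / s) - ∫ s in Set.Ioi ε, Real.exp (-s) / s) -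
            ((∫ s in Set.Ioi (t₀ * lam), Real.exp (-s) / s) -
              ∫ s in Set.Ioi t₀, Real.exp (-s) / s)) := by
    intro ε hε hεt
    obtain ⟨hε1, hε2⟩ := frullani_integral_uv_Ioi hε hlam
    obtain ⟨-, ht2⟩ := frullani_integral_uv_Ioi ht₀ hlam
    rw [← hε2, ← ht2, intervalIntegral.integral_Ioi_sub_Ioi hε1 hεt,
      intervalIntegral.integral_of_le hεt,
      ← setIntegral_union (Set.Ioc_disjoint_Ioc_of_le le_rfl) measurableSet_Ioc
        (hI.mono_set (Set.Ioc_subset_Ioc_right hεt))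
        (hI.mono_set (Set.Ioc_subset_Ioc_left hε.le)),
      Set.Ioc_union_Ioc_eq_Ioc hε.le hεt]
  -- the defect is `O(ε)` for every `0 < ε ≤ t₀`
  have hbound : ∀ ε, 0 < ε → ε ≤ t₀ →
      |(-∫ t in Set.Ioc 0 t₀, (Real.exp (-(t * lam)) - Real.exp (-t)) / t) -
          (∫ s in Set.Ioi (t₀ * lam), Real.exp (-s) / s) +
            (∫ s in Set.Ioi t₀, Real.exp (-s) / s) - Real.log lam| ≤ 2 * (ε * |lam - 1|) := by
    intro ε hε hεt
    rw [hsplit ε hε hεt]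
    exact frullani_bookkeeping (frullani_abs_uv_le_mul ε lam hε hlam.le)
      (frullani_abs_expInt_sub_expInt_sub_log_le hε hlam)
  have hev := (Filter.eventually_mem_set.mpr (Ioc_mem_nhdsGT ht₀)).mono
    fun ε hε => hbound ε hε.1 hε.2
  have htend : Tendsto (fun ε : ℝ => 2 * (ε * |lam - 1|)) (𝓝[>] 0) (𝓝 0) := by
    have h : Tendsto (fun ε : ℝ => 2 * (ε * |lam - 1|)) (𝓝 0) (𝓝 (2 * (0 * |lam - 1|))) :=
      tendsto_const_nhds.mul (tendsto_id.mul tendsto_const_nhds)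
    rw [zero_mul, mul_zero] at h
    exact h.mono_left nhdsWithin_le_nhds
  have h0 := abs_nonpos_iff.mp (ge_of_tendsto htend hev)
  linarith

/-- Part (b): `0 ≤ E₁(x) ≤ e^{-x}/x` for `x > 0`. -/
theorem frullani_expInt_nonneg_le (x : ℝ) (hx : 0 < x) :
    0 ≤ ∫ s in Set.Ioi x, Real.exp (-s) / s ∧
      ∫ s in Set.Ioi x, Real.exp (-s) / s ≤ Real.exp (-x) / x := by
  refine ⟨setIntegral_nonneg measurableSet_Ioi fun s hs =>
    div_nonneg (Real.exp_pos _).le (hx.trans hs).le, ?_⟩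
  calc ∫ s in Set.Ioi x, Real.exp (-s) / s ≤ ∫ s in Set.Ioi x, Real.exp (-s) / x :=
        setIntegral_mono_on (frullani_integrableOn_exp_neg_div hx)
          ((integrableOn_exp_neg_Ioi x).div_const x) measurableSet_Ioi
          fun s hs => div_le_div_of_nonneg_left (Real.exp_pos _).le hx hs.le
    _ = Real.exp (-x) / x := by rw [integral_div, integral_exp_neg_Ioi]

/-- `|∫_{(c,t₀]} (e^{-tλ} - e^{-t})/t dt| ≤ log (t₀ / c)` for `0 < c ≤ t₀`. -/
theorem frullani_abs_integral_Ioc_le_log {c t₀ lam : ℝ} (hc : 0 < c) (hct : c ≤ t₀)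
    (hlam : 0 ≤ lam) :
    |∫ t in Set.Ioc c t₀, (Real.exp (-(t * lam)) - Real.exp (-t)) / t| ≤
      Real.log (t₀ / c) := by
  have hpos : ∀ t ∈ Set.uIcc c t₀, t ≠ 0 := by
    intro t ht
    rw [Set.uIcc_of_le hct] at ht
    exact (hc.trans_le ht.1).ne'
  have hint : IntegrableOn (fun t : ℝ => t⁻¹) (Set.Ioc c t₀) :=
    (intervalIntegrable_iff_integrableOn_Ioc_of_le hct).mp
      (intervalIntegral.intervalIntegrable_inv hpos continuousOn_id)
  calc |∫ t in Set.Ioc c t₀, (Real.exp (-(t * lam)) - Real.exp (-t)) / t|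
        = ‖∫ t in Set.Ioc c t₀, (Real.exp (-(t * lam)) - Real.exp (-t)) / t‖ :=
          (Real.norm_eq_abs _).symm
    _ ≤ ∫ t in Set.Ioc c t₀, t⁻¹ := by
        refine norm_integral_le_of_norm_le hint ?_
        filter_upwards [ae_restrict_mem measurableSet_Ioc] with t ht
        rw [Real.norm_eq_abs]
        exact frullani_abs_integrand_le_inv (hc.trans ht.1) hlam
    _ = Real.log (t₀ / c) := by
        rw [← intervalIntegral.integral_of_le hct, integral_inv_of_pos hc (hc.trans_le hct)]

/-- Part (d): `|uv(t₀,λ)| ≤ 4 + log (1 + λ) + log t₀` for `t₀ ≥ 1`, `λ ≥ 0`. -/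
theorem frullani_abs_uv_le_log (t₀ lam : ℝ) (ht₀ : 1 ≤ t₀) (hlam : 0 ≤ lam) :
    |(-∫ t in Set.Ioc 0 t₀, (Real.exp (-(t * lam)) - Real.exp (-t)) / t)| ≤
      4 + Real.log (1 + lam) + Real.log t₀ := by
  have hl1 : 0 < 1 + lam := by linarith
  have hc0 : 0 < (1 + lam)⁻¹ := inv_pos.mpr hl1
  have hc1 : (1 + lam)⁻¹ ≤ 1 := inv_le_one_of_one_le₀ (by linarith)
  have hct : (1 + lam)⁻¹ ≤ t₀ := hc1.trans ht₀
  have hI : IntegrableOn (fun t : ℝ => (Real.exp (-(t * lam)) - Real.exp (-t)) / t)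
      (Set.Ioc 0 t₀) := frullani_integrableOn_Ioc hlam
  have hsplit : ∫ t in Set.Ioc 0 t₀, (Real.exp (-(t * lam)) - Real.exp (-t)) / t =
      (∫ t in Set.Ioc 0 (1 + lam)⁻¹, (Real.exp (-(t * lam)) - Real.exp (-t)) / t) +
        ∫ t in Set.Ioc (1 + lam)⁻¹ t₀, (Real.exp (-(t * lam)) - Real.exp (-t)) / t := by
    rw [← setIntegral_union (Set.Ioc_disjoint_Ioc_of_le le_rfl) measurableSet_Ioc
        (hI.mono_set (Set.Ioc_subset_Ioc_right hct))
        (hI.mono_set (Set.Ioc_subset_Ioc_left hc0.le)),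
      Set.Ioc_union_Ioc_eq_Ioc hc0.le hct]
  have h1 :
      |∫ t in Set.Ioc 0 (1 + lam)⁻¹, (Real.exp (-(t * lam)) - Real.exp (-t)) / t| ≤ 1 := by
    have h := frullani_abs_uv_le_mul (1 + lam)⁻¹ lam hc0 hlam
    rw [abs_neg] at h
    refine h.trans ?_
    have hl : |lam - 1| ≤ 1 + lam := abs_sub_le_iff.mpr ⟨by linarith, by linarith⟩
    calc (1 + lam)⁻¹ * |lam - 1|
          ≤ (1 + lam)⁻¹ * (1 + lam) := mul_le_mul_of_nonneg_left hl hc0.le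
      _ = 1 := inv_mul_cancel₀ hl1.ne'
  have h2 : |∫ t in Set.Ioc (1 + lam)⁻¹ t₀, (Real.exp (-(t * lam)) - Real.exp (-t)) / t| ≤
      Real.log t₀ + Real.log (1 + lam) := by
    have hlog : Real.log (t₀ / (1 + lam)⁻¹) = Real.log t₀ + Real.log (1 + lam) := by
      rw [div_inv_eq_mul, Real.log_mul (by linarith) hl1.ne']
    exact (frullani_abs_integral_Ioc_le_log hc0 hct hlam).trans hlog.le
  rw [abs_neg, hsplit]
  calc _ ≤ |∫ t in Set.Ioc 0 (1 + lam)⁻¹, (Real.exp (-(t * lam)) - Real.exp (-t)) / t| +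
        |∫ t in Set.Ioc (1 + lam)⁻¹ t₀, (Real.exp (-(t * lam)) - Real.exp (-t)) / t| :=
          abs_add_le _ _
    _ ≤ 1 + (Real.log t₀ + Real.log (1 + lam)) := add_le_add h1 h2
    _ ≤ 4 + Real.log (1 + lam) + Real.log t₀ := by linarith

/-- **Frullani toolkit** (registered stub `stub_frullaniToolkit`):
(a) `log λ = uv(t₀,λ) − E₁(t₀λ) + E₁(t₀)`; (b) `0 ≤ E₁(x) ≤ e^{−x}/x` (`x > 0`);
(c) `|uv| ≤ t₀|λ−1|`; (d) `|uv| ≤ 4 + log(1+λ) + log t₀` (`t₀ ≥ 1`). -/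
theorem stub_frullaniToolkit :
    (∀ t₀ lam : ℝ, 0 < t₀ → 0 < lam →
        Real.log lam =
          (-∫ t in Set.Ioc 0 t₀, (Real.exp (-(t * lam)) - Real.exp (-t)) / t) -
            (∫ s in Set.Ioi (t₀ * lam), Real.exp (-s) / s) + ∫ s in Set.Ioi t₀, Real.exp (-s) / s) ∧
    (∀ x : ℝ, 0 < x →
        0 ≤ ∫ s in Set.Ioi x, Real.exp (-s) / s ∧
          ∫ s in Set.Ioi x, Real.exp (-s) / s ≤ Real.exp (-x) / x) ∧
    (∀ t₀ lam : ℝ, 0 < t₀ → 0 ≤ lam →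
        |(-∫ t in Set.Ioc 0 t₀, (Real.exp (-(t * lam)) - Real.exp (-t)) / t)| ≤ t₀ * |lam - 1|) ∧
    (∀ t₀ lam : ℝ, 1 ≤ t₀ → 0 ≤ lam →
        |(-∫ t in Set.Ioc 0 t₀, (Real.exp (-(t * lam)) - Real.exp (-t)) / t)| ≤
          4 + Real.log (1 + lam) + Real.log t₀) :=
  ⟨frullani_log_eq_uv_sub_expInt_add_expInt, frullani_expInt_nonneg_le, frullani_abs_uv_le_mul,
    frullani_abs_uv_le_log⟩

end Summit.QuantumFields.QCD.Cruxes.SeaFactorisationBridge.ProperTimeQuarantine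

end
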